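import Mathlib
import HarnessLib
import Summits.HubbardSuperconductivity.HubbardSuperconductivity.Theorems.KLProgrammeKLRegimeEngineV8TowerExports2

/-!
# Route `KLProgramme` — crux K3 ENGINE (stmt-HubbardSuperconductivity-20437 `KLRegimeEngineV17F2`), stub (b) v2: THE LEVELS CONJUNCT OF THE TOWER
# PACKAGE FROM THE CLASS-#1 EXPORT BINDER `hlevU` («(b)-CLOSER CENSUS» FINDING A; cell gate-hubbard-kl, seat gate-hubbard-kl-p3 g23)

WHY.  Stub (b) `stub_engine_step_norms` (r16 V1 row 2c2ad3b44ff7) is closed modulo three producers by `EngineV8.A24A25ZG14.stub_engine_step_norms_of_producers hexT hexI hexG`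
(…EngineV17F2ClosersG8); `hexT` is the (capped) atom-free core `TowerCoreStepV2 klEngGeo14 P R (klEngQ8 P R) CE u cT = TowerLevelsStepV2 ∧ TowerFirstMomentsStepV2`
(…TowerCoreDefsC).  `TowerLevelsStepV2` carries, verbatim from the stub, the class-#1 export binder
`hlevU : ∀ j ≤ n, LevelsUExportMixedAt L M (klCU2 P R (klEngQ7 P R)) P β U μ j`, whose instance at `j := n` already gives the thin levelled rows
`LevelsUAt … (K_n) i` of `𝒱_i[K_n]` at EVERY level `i ≤ n` in U-currency (table `klCU2 …`, floor gains included, …TowerExports2 §1).  The landed bridge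
`KLRegimeSplit.kernelNormsLevels_of_levelsUAt` (…TowerExports §1: a table dominated by `Q.CE^p` gives `KernelNormsLevels` back, `Klam|U| ≤ ε_j`) was never composed with it.
This file does the composition, so that the LEVELS conjunct of `TowerLevelsStepV2` needs no tower, no E1 row and no numerics — only a package constant
`CE ≥ max 1 (klCU2 P R (klEngQ7 P R) 3) · max 1 (klCUA2 P R (klEngQ7 P R))` (the geometric envelope of the class-#1 table, `isGeomTable_klCU2`):
* `isGeomTable_le_envelope_pow` — a geometric table (`IsGeomTable c A`: `c (p+1) ≤ A·c p` from `p = 3`) satisfies `c p ≤ (max 1 (c 3) · max 1 A)^p` for `p ≥ 3`;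
* **`kernelNormsLevels_flow_of_levelsUExportMixedAt`** — `P.WF`, `max 1 (klCU2 … 3) · max 1 (klCUA2 …) ≤ Q.CE`, `LevelsUExportMixedAt … n` ⟹ `∀ j ≤ n, KernelNormsLevels L M P Q β U μ (K_n) j`;
* **`kernelNormsLevels_flow_of_hlevU`** — the same from the stub's binder shape `∀ j ≤ n, LevelsUExportMixedAt … j`;
* `sixCells_of_kernelNormsLevels` — the (ℓ) head's six-leg CELL row (`levelCount Ωe = 1`, no gain) is a corollary of `KernelNormsLevels` at the same level (`0 ≤ Q.CE`),
  hence of `hlevU` as well (`sixCells_flow_of_hlevU`).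
The WEIGHTED conjunct `KernelNormsWt4` is NOT touched (the export is unweighted).  Bookkeeping over landed decls; nothing asserts (b), (X).1, any stub, K3 or superconductivity.
References: BGM 2006 §2.8 (2.76)–(2.80), Lemma 2.5 (2.98) [cite: BenfattoGiulianiMastropietro2006].
-/

noncomputable section

namespace Summit.HubbardSuperconductivity.HubbardSuperconductivity.Theorems.EngineV8

set_option linter.dupNamespace false -- summit = problem name (single-conjunct summit), D-0017

open Real Finset Literature.MathematicalPhysics.QuantumLattice Literature.Probability.LatticeModels
open Literature.MathematicalPhysics.QuantumLattice.FermiRG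
open Summit.HubbardSuperconductivity.HubbardSuperconductivity.Theorems.KLRegimeSplit
open Summit.HubbardSuperconductivity.HubbardSuperconductivity.Theorems.KLProgrammeLegKernels
open Summit.HubbardSuperconductivity.HubbardSuperconductivity.Theorems.DispersionFlow

/-! ## §1 The geometric envelope of a class-#1 table -/

/-- **A geometric table is dominated by the powers of its envelope constant**: `IsGeomTable c A` (`0 ≤ c`, `0 ≤ A`, `c (p+1) ≤ A·c p` for `p ≥ 3`) gives
`c p ≤ (max 1 (c 3) · max 1 A)^p` for every `p ≥ 3`. [folklore] -/
theorem isGeomTable_le_envelope_pow {c : ℕ → ℝ} {A : ℝ} (h : IsGeomTable c A) {p : ℕ} (hp : 3 ≤ p) :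
    c p ≤ (max 1 (c 3) * max 1 A) ^ p := by
  obtain ⟨_, hA, hstep⟩ := h
  have key : ∀ k : ℕ, c (3 + k) ≤ c 3 * A ^ k := by
    intro k
    induction k with
    | zero => simp
    | succ k ih =>
      calc c (3 + (k + 1)) = c (3 + k + 1) := by rw [Nat.add_assoc]
        _ ≤ A * c (3 + k) := hstep _ (by omega)
        _ ≤ A * (c 3 * A ^ k) := mul_le_mul_of_nonneg_left ih hA
        _ = c 3 * A ^ (k + 1) := by ring
  obtain ⟨k, rfl⟩ : ∃ k, p = 3 + k := ⟨p - 3, by omega⟩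
  have h1 : (1 : ℝ) ≤ max 1 (c 3) := le_max_left _ _
  have h2 : (1 : ℝ) ≤ max 1 A := le_max_left _ _
  calc c (3 + k) ≤ c 3 * A ^ k := key k
    _ ≤ max 1 (c 3) * max 1 A ^ k :=
        mul_le_mul (le_max_right _ _) (pow_le_pow_left₀ hA (le_max_right _ _) k) (pow_nonneg hA _) (zero_le_one.trans h1)
    _ ≤ max 1 (c 3) ^ (3 + k) * max 1 A ^ (3 + k) := by
        apply mul_le_mul
        · calc max 1 (c 3) = max 1 (c 3) ^ 1 := (pow_one _).symm
            _ ≤ max 1 (c 3) ^ (3 + k) := pow_le_pow_right₀ h1 (by omega)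
        · exact pow_le_pow_right₀ h2 (by omega)
        · exact pow_nonneg (zero_le_one.trans h2) _
        · exact pow_nonneg (zero_le_one.trans h1) _
    _ = (max 1 (c 3) * max 1 A) ^ (3 + k) := (mul_pow _ _ _).symm

/-- The envelope constant is at least one. [folklore] -/
theorem one_le_envelope (c : ℕ → ℝ) (A : ℝ) : (1 : ℝ) ≤ max 1 (c 3) * max 1 A :=
  one_le_mul_of_one_le_of_one_le (le_max_left _ _) (le_max_left _ _)

/-! ## §2 The levels conjunct of `TowerLevelsStepV2` from the export binder -/

variable {L M : ℕ} [NeZero L] [NeZero M]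

/-- **THE LEVELS AT EVERY `j ≤ n` ON THE FLOW FRAME FROM THE SCALE-`n` MERGED EXPORT**: if `P.WF`, the package constant dominates the geometric envelope of the
class-#1 table (`max 1 (klCU2 P R (klEngQ7 P R) 3) · max 1 (klCUA2 P R (klEngQ7 P R)) ≤ Q.CE`) and `LevelsUExportMixedAt L M (klCU2 P R (klEngQ7 P R)) P β U μ n` holds,
then `KernelNormsLevels L M P Q β U μ (K_n) j` at every `j ≤ n` (`kernelNormsLevels_of_levelsUAt` ∘ `isGeomTable_le_envelope_pow` ∘ `isGeomTable_klCU2`).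
[cite: BenfattoGiulianiMastropietro2006, Lemma 2.5 (2.98)] -/
theorem kernelNormsLevels_flow_of_levelsUExportMixedAt (P : SplitConsts) (R : RenConsts) (hP : P.WF) {Q : EngConsts}
    (hCE : max 1 (klCU2 P R (klEngQ7 P R) 3) * max 1 (klCUA2 P R (klEngQ7 P R)) ≤ Q.CE)
    {β U μ : ℝ} {n : ℕ} (h : LevelsUExportMixedAt L M (klCU2 P R (klEngQ7 P R)) P β U μ n) :
    ∀ j ≤ n, KernelNormsLevels L M P Q β U μ (klFlowFrameU L M β U μ n) j := by
  intro j hj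
  have hK : 0 ≤ P.Klam := zero_le_one.trans hP.1
  have h1 := one_le_envelope (klCU2 P R (klEngQ7 P R)) (klCUA2 P R (klEngQ7 P R))
  have hQ : 0 ≤ Q.CE := (zero_le_one.trans h1).trans hCE
  refine kernelNormsLevels_of_levelsUAt hK hQ (h.levelsUAt hj) fun p hp => ?_
  exact (isGeomTable_le_envelope_pow (isGeomTable_klCU2 P R (klEngQ7 P R)) hp).trans
    (pow_le_pow_left₀ (zero_le_one.trans h1) hCE p)

/-- **THE LEVELS CONJUNCT OF `TowerLevelsStepV2` FROM ITS OWN BINDER `hlevU`** (stub (b)'s shape `∀ j ≤ n, LevelsUExportMixedAt … j`, read at `j := n`):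
`∀ j ≤ n, KernelNormsLevels L M P Q β U μ (K_n) j` for every `Q` with `max 1 (klCU2 … 3) · max 1 (klCUA2 …) ≤ Q.CE`.  No tower, no E1 row, no numerics.
[cite: BenfattoGiulianiMastropietro2006, Lemma 2.5 (2.98)] -/
theorem kernelNormsLevels_flow_of_hlevU (P : SplitConsts) (R : RenConsts) (hP : P.WF) {Q : EngConsts}
    (hCE : max 1 (klCU2 P R (klEngQ7 P R) 3) * max 1 (klCUA2 P R (klEngQ7 P R)) ≤ Q.CE)
    {β U μ : ℝ} {n : ℕ} (hlevU : ∀ j ≤ n, LevelsUExportMixedAt L M (klCU2 P R (klEngQ7 P R)) P β U μ j) :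
    ∀ j ≤ n, KernelNormsLevels L M P Q β U μ (klFlowFrameU L M β U μ n) j :=
  kernelNormsLevels_flow_of_levelsUExportMixedAt P R hP hCE (hlevU n le_rfl)

/-! ## §3 The six-leg cells are a corollary of the levels -/

omit [NeZero M] in
/-- **The six-leg CELL row of the (ℓ) head is a corollary of `KernelNormsLevels` at the same frame and level** (`p = 3`; the gain factor
`((2^j)⁻¹)^{levelGainExp (levelCount Ωe)} ≤ 1` is dropped; `0 ≤ Q.CE`): for every prescription `Ωe` of the six legs,
`klAnisoLegKernelNormAt L M β U μ K klE0 j (2*3) Ωe ≤ Q.CE^3 · ε_j^2 · 2^{4j}`. [cite: BenfattoGiulianiMastropietro2006, Lemma 2.5 (2.98)] -/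
theorem sixCells_of_kernelNormsLevels {P : SplitConsts} {Q : EngConsts} (hQ : 0 ≤ Q.CE) {β U μ : ℝ} {K : TrigPolyC4v} {j : ℕ}
    (h : KernelNormsLevels L M P Q β U μ K j) (Ωe : Fin (2 * 3) → Option (SectorLeg (sectorCount j))) :
    klAnisoLegKernelNormAt L M β U μ K klE0 j (2 * 3) Ωe ≤ Q.CE ^ 3 * (epsCoupling P U j) ^ 2 * (2 : ℝ) ^ ((4 : ℤ) * j) := by
  refine (h 3 le_rfl Ωe).trans ?_
  have hz : ((3 * ((3 : ℕ) : ℤ) - 5) * (j : ℤ)) = (4 : ℤ) * j := by norm_num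
  have h31 : (3 : ℕ) - 1 = 2 := by norm_num
  rw [hz, h31]
  have hA : 0 ≤ Q.CE ^ 3 * epsCoupling P U j ^ 2 * (2 : ℝ) ^ ((4 : ℤ) * j) :=
    mul_nonneg (mul_nonneg (pow_nonneg hQ 3) (sq_nonneg _)) (zpow_nonneg (by norm_num) _)
  have hg : (((2 : ℝ) ^ j)⁻¹) ^ levelGainExp (levelCount Ωe) ≤ 1 :=
    pow_le_one₀ (by positivity) (inv_le_one_of_one_le₀ (one_le_pow₀ (by norm_num)))
  calc Q.CE ^ 3 * epsCoupling P U j ^ 2 * (2 : ℝ) ^ ((4 : ℤ) * j) * (((2 : ℝ) ^ j)⁻¹) ^ levelGainExp (levelCount Ωe)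
      ≤ Q.CE ^ 3 * epsCoupling P U j ^ 2 * (2 : ℝ) ^ ((4 : ℤ) * j) * 1 := mul_le_mul_of_nonneg_left hg hA
    _ = Q.CE ^ 3 * (epsCoupling P U j) ^ 2 * (2 : ℝ) ^ ((4 : ℤ) * j) := mul_one _

/-- **The (ℓ) head's six-leg cell binder from `hlevU`** (every `j ≤ n`, every prescription — in particular `levelCount Ωe = 1`).
[cite: BenfattoGiulianiMastropietro2006, Lemma 2.5 (2.98)] -/
theorem sixCells_flow_of_hlevU (P : SplitConsts) (R : RenConsts) (hP : P.WF) {Q : EngConsts}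
    (hCE : max 1 (klCU2 P R (klEngQ7 P R) 3) * max 1 (klCUA2 P R (klEngQ7 P R)) ≤ Q.CE)
    {β U μ : ℝ} {n : ℕ} (hlevU : ∀ j ≤ n, LevelsUExportMixedAt L M (klCU2 P R (klEngQ7 P R)) P β U μ j) :
    ∀ j : ℕ, 1 ≤ j → j ≤ n → ∀ Ωe : Fin (2 * 3) → Option (SectorLeg (sectorCount j)), levelCount Ωe = 1 →
      klAnisoLegKernelNormAt L M β U μ (klFlowFrameU L M β U μ n) klE0 j (2 * 3) Ωe ≤
        Q.CE ^ 3 * (epsCoupling P U j) ^ 2 * (2 : ℝ) ^ ((4 : ℤ) * j) := by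
  intro j _ hj Ωe _
  have h1 := one_le_envelope (klCU2 P R (klEngQ7 P R)) (klCUA2 P R (klEngQ7 P R))
  exact sixCells_of_kernelNormsLevels ((zero_le_one.trans h1).trans hCE) (kernelNormsLevels_flow_of_hlevU P R hP hCE hlevU j hj) Ωe

end Summit.HubbardSuperconductivity.HubbardSuperconductivity.Theorems.EngineV8

end
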